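import Literature.Computability.Cryptography.HallgrenClassGroup

/-!
# Stub `stub_oneSidedAP` of line `Sketch` (v2) for the crux `ArithStatLadder.IqThreeNotPPoly`

Exact one-sidedness of the planted one-parameter family of binary cubic forms
`f = x³ − x²y + N t y³`, `t = 1 + 2 N k`, whose absolute discriminant is `d = N t (27 N t − 4)`:
if the modulus `N` is NOT squarefree, then `d` is never a member of the crux's set
`S = {d : −d is a negative fundamental discriminant ∧ 3 ∣ h(−d)}`; already the fundamentality
conjunct fails.

Mathematics. `¬ Squarefree N` gives a prime `p` with `p² ∣ N` (also for `N = 0`), and `N ∣ d`.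
If `p` is odd then `p² ∣ d`, so neither `−d` nor `(−d)/4` is squarefree. If `p = 2` then `4 ∣ N t`
and `4 ∣ 27 N t − 4`, hence `16 ∣ d`, so `−d ≡ 0 (mod 4)` and `(−d)/4 ≡ 0 (mod 4)`, excluding both
branches of `IsNegFundamentalDiscr`.

The two divisibility exclusions are the same arguments as the helper theorems
`not_isNegFundamentalDiscr_of_sixteen_dvd` / `not_isNegFundamentalDiscr_of_odd_prime_sq_dvd` of the
sibling stub file `ArithStatLadderIqThreeNotPPolyStubOneSided` (stub `stub_oneSided`); they are
inlined here so that this file builds from `HallgrenClassGroup` alone.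
-/

set_option linter.dupNamespace false -- D-0017: single-problem summit ⇒ `QuantumAdvantage.QuantumAdvantage` by design

namespace Summit.QuantumAdvantage.QuantumAdvantage.Theorems.IqThreeNotPPoly

open scoped Classical
open Literature.Computability.Cryptography (IsNegFundamentalDiscr)
open Literature.NumberTheory.QuadraticFields

/-- **Stub · `stub_oneSidedAP`.** For a non-squarefree modulus `N`, the absolute discriminant
`d = N t (27 N t − 4)`, `t = 1 + 2 N k`, of the planted form `x³ − x²y + N t y³` is never in the
crux's set `{d : −d fundamental ∧ 3 ∣ h(−d)}`: the fundamentality conjunct already fails, because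
`d` inherits the square factor of `N` (`p` odd: `p² ∣ N ∣ d`, so neither `−d` nor `(−d)/4` is
squarefree; `p = 2`: `4 ∣ N t` and `4 ∣ 27 N t − 4`, so `16 ∣ d` and both residue conditions
`−d ≡ 1 (mod 4)` / `(−d)/4 ≡ 2, 3 (mod 4)` fail). -/
theorem stub_oneSidedAP :
    ∀ (N k : ℕ), ¬ Squarefree N →
      N * (1 + 2 * N * k) * (27 * N * (1 + 2 * N * k) - 4) ∉
        {d : ℕ | IsNegFundamentalDiscr d ∧ 3 ∣ BinaryQuadraticForm.classNumber (-(d : ℤ))} := by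
  intro N k hN hmem
  rw [Nat.squarefree_iff_prime_squarefree] at hN
  push Not at hN
  obtain ⟨p, hp, hpN⟩ := hN
  rw [Set.mem_setOf_eq] at hmem
  obtain ⟨hfund, -⟩ := hmem
  revert hfund
  generalize hd : N * (1 + 2 * N * k) * (27 * N * (1 + 2 * N * k) - 4) = d
  rcases eq_or_ne p 2 with rfl | hp2
  · -- `4 ∣ N`, hence `4 ∣ N t` and `4 ∣ 27 N t − 4`, so `16 ∣ d`: both residue conditions fail
    have h4 : 4 ∣ N := hpN
    have hNt : 4 ∣ N * (1 + 2 * N * k) := h4.mul_right _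
    have hu : 4 ∣ 27 * N * (1 + 2 * N * k) - 4 :=
      Nat.dvd_sub ((h4.mul_left 27).mul_right _) (dvd_refl 4)
    have h16 : 16 ∣ d := by
      rw [← hd]
      exact dvd_trans (by decide : (16 : ℕ) ∣ 4 * 4) (Nat.mul_dvd_mul hNt hu)
    clear hd hNt hu
    rintro (⟨h1, -, -⟩ | ⟨-, h2, -⟩) <;> omega
  · -- `p` odd, `p² ∣ N ∣ d`: neither `−d` nor `(−d)/4` is squarefree
    have hpd : p * p ∣ d := hd ▸ (hpN.mul_right _).mul_right _
    have hpu : ¬ IsUnit p := hp.not_isUnit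
    clear hd
    rintro (⟨-, hsq, -⟩ | ⟨h4, -, hsq⟩)
    · rw [← Int.squarefree_natAbs, Int.natAbs_neg, Int.natAbs_natCast] at hsq
      exact hpu (hsq p hpd)
    · have h4' : 4 ∣ d := Int.natCast_dvd_natCast.1 (dvd_neg.1 h4)
      obtain ⟨q, rfl⟩ := h4'
      have he : (-((4 * q : ℕ) : ℤ)) / 4 = -(q : ℤ) := by push_cast; omega
      rw [he, ← Int.squarefree_natAbs, Int.natAbs_neg, Int.natAbs_natCast] at hsq
      have hcop : Nat.Coprime (p * p) 4 := by
        simpa [pow_two] using Nat.coprime_pow_primes 2 2 hp Nat.prime_two hp2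
      exact hpu (hsq p (hcop.dvd_of_dvd_mul_left hpd))

end Summit.QuantumAdvantage.QuantumAdvantage.Theorems.IqThreeNotPPoly
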